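import Summits.QuantumAdvantage.QuantumAdvantage.Theorems.CubicForrelationNearExactIsExactTwelveOddWeightLight
import Summits.QuantumAdvantage.QuantumAdvantage.Theorems.CubicForrelationNearExactIsExactCubicForm
import Summits.QuantumAdvantage.QuantumAdvantage.Theorems.CubicForrelationNearExactIsExactTwelvePartnerRadical

/-!
# Crux `CubicForrelation.NearExactIsExact` (stmt-QuantumAdvantage-14043) — n = 12, E1280-even: the TOP of the partner route —
  a light cubic with a PAIRING PARTNER has an R2 or an R4 direction (the period branch dies on the radical)

Certificate seat `b2b-cforr-cert` (gen 42).  HONEST FRAMING: kernel-checked bookkeeping (standard axioms) that fixes the INTERFACE of the two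
remaining branch files of the Lean roadmap for `E1280-even` (HOME/b2b-cforr-cert-g39/E1280-HANDPROOFS.md §3, HOME/b2b-cforr-cert-g40/
LEAN-PLAN-E1280-EVEN.md): it is the analogue of `tow_weight_ge_1280` (THEOREM W, the odd case) with the two branch statements `HR2`, `HR4`
as explicit hypotheses.  Nothing about `θ₁₂` is proved here (θ₁₂ ∈ [57/64, 29/32) is formally unchanged); NOT summit progress.

SETTING.  `κ` is a cubic Boolean function on 12 bits; `d` is its CUBIC FORM at unit vectors, `d φ j k = [D_{e_φ}D_{e_j}D_{e_k}κ(0)]` read in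
`𝔽₂` (hypothesis `hd`, literally the right-hand side of `tcp_d_eq_third`); `c` is a PAIRING PARTNER: `Σ_{j<k} c_{pjk} d_{φjk} = [p = φ]`
(hypothesis `hpair`; for the digit class of a type-O cubic this is `tcp_pair`, the (L6) bridge).
* `tpw_d_symm`: `d` is symmetric with vanishing diagonals (`tcf_third_swap12/23`, `tcf_third_diag12`).
* `tpw_third_zero_of_period`, `tpw_no_period_of_partner`: a period `a` of `κ` (`κ(x ⊕ a) = κ x`) is a radical vector of `d`
  (`tcf_third_sum1`), hence `a = 0` by `tpr_radical_obstruction` — the partner route needs NO separate no-period lemma.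
* `tpw_pair_weight_pos`: a function with a partnered cubic form is not identically `0`.
* `tpw_weight_ge_1280_of_branches`: GIVEN the branch statements
    `HR2`: (κ cubic, `c` symmetric partner of `d`, `a ≠ 0` with `#{κ ≠ κ(·⊕a)} = 1024`) ⇒ `wt κ ≥ 1280`,
    `HR4`: the same with `1536`,
  every cubic `κ` on 12 bits with a partnered cubic form has `wt κ ≥ 1280`
  (`tow_light_derivative` + `stub_derivDegree` + `tow_quadratic_light` give a direction with `0`, `1024` or `1536` changes; `0` is a period).
`HR2` is the content of R2-PARTNER.md + HANDPROOFS §1 (frame `tcr2_adapted`, cells, K–T, cell lemmas, leaves `tpa_R2_*`); `HR4` that of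
R4-PARTNER.md + HANDPROOFS §2.  Both remain TO BE ASSEMBLED in Lean; this file only pins their exact statements.

References: this seat lineage (g33 dual form / pairing, g37 partner criterion, g39 hand proofs, g40–41 tools).  Axioms: the standard three.
-/

set_option linter.dupNamespace false -- D-0017: single-problem summit ⇒ `QuantumAdvantage.QuantumAdvantage` by design

namespace Summit.QuantumAdvantage.QuantumAdvantage.Theorems.CubicForrelation.NearExactIsExact

open Finset
open Literature.Computability.QuantumComplexity
open Literature.Computability.QuantumComplexity.BuzetChailloux (bxor zeroVec bxor_comm bxor_self bxor_zeroVec zeroVec_bxor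
  bxor_bxor_cancel_left)

/-! ### The cubic form at unit vectors is a symmetric tensor with zero diagonals -/

/-- **Symmetries of the cubic-form tensor.**  If `d φ j k = [D_{e_φ}D_{e_j}D_{e_k}κ(0)]` then `d` is symmetric under both transpositions
and vanishes when two indices coincide. [cite: Carlet2020, §2.2] -/
theorem tpw_d_symm {n : ℕ} (κ : (Fin n → Bool) → Bool) (d : Fin n → Fin n → Fin n → ZMod 2)
    (hd : ∀ φ j k, d φ j k =
      if (((κ zeroVec ^^ κ (bxor zeroVec (fun l => decide (l = k)))) ^^
            (κ (bxor zeroVec (fun l => decide (l = j))) ^^ κ (bxor (bxor zeroVec (fun l => decide (l = j))) (fun l => decide (l = k))))) ^^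
          ((κ (bxor zeroVec (fun l => decide (l = φ))) ^^ κ (bxor (bxor zeroVec (fun l => decide (l = φ))) (fun l => decide (l = k)))) ^^
            (κ (bxor (bxor zeroVec (fun l => decide (l = φ))) (fun l => decide (l = j))) ^^
              κ (bxor (bxor (bxor zeroVec (fun l => decide (l = φ))) (fun l => decide (l = j))) (fun l => decide (l = k)))))) = true
      then 1 else 0) :
    (∀ φ j k, d φ k j = d φ j k) ∧ (∀ φ j k, d j φ k = d φ j k) ∧ (∀ φ j, d φ j j = 0) := by
  refine ⟨fun φ j k => ?_, fun φ j k => ?_, fun φ j => ?_⟩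
  · rw [hd φ k j, hd φ j k, tcf_third_swap23 κ (fun l => decide (l = φ)) (fun l => decide (l = k)) (fun l => decide (l = j)) zeroVec]
  · rw [hd j φ k, hd φ j k, tcf_third_swap12 κ (fun l => decide (l = j)) (fun l => decide (l = φ)) (fun l => decide (l = k)) zeroVec]
  · rw [hd φ j j, tcf_third_swap12 κ (fun l => decide (l = φ)) (fun l => decide (l = j)) (fun l => decide (l = j)) zeroVec,
      tcf_third_swap23 κ (fun l => decide (l = j)) (fun l => decide (l = φ)) (fun l => decide (l = j)) zeroVec,
      tcf_third_diag12 κ (fun l => decide (l = j)) (fun l => decide (l = φ)) zeroVec]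
    exact if_neg Bool.false_ne_true

/-! ### A period is a radical vector of the cubic form -/

/-- **A period kills the third difference.**  If `κ(x ⊕ a) = κ(x)` for all `x` then `D_aD_vD_wκ ≡ 0` (any `κ`). [folklore] -/
theorem tpw_third_zero_of_period {n : ℕ} (κ : (Fin n → Bool) → Bool) (a : Fin n → Bool) (hper : ∀ x, κ (bxor x a) = κ x)
    (v w x : Fin n → Bool) :
    (((κ x ^^ κ (bxor x w)) ^^ (κ (bxor x v) ^^ κ (bxor (bxor x v) w))) ^^
        ((κ (bxor x a) ^^ κ (bxor (bxor x a) w)) ^^ (κ (bxor (bxor x a) v) ^^ κ (bxor (bxor (bxor x a) v) w)))) = false := by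
  have e2 : bxor (bxor x a) v = bxor (bxor x v) a := by
    rw [iw_bxor_assoc, bxor_comm a v, ← iw_bxor_assoc]
  have e1 : bxor (bxor x a) w = bxor (bxor x w) a := by
    rw [iw_bxor_assoc, bxor_comm a w, ← iw_bxor_assoc]
  have e3 : bxor (bxor (bxor x a) v) w = bxor (bxor (bxor x v) w) a := by
    rw [e2, iw_bxor_assoc (bxor x v) a w, bxor_comm a w, ← iw_bxor_assoc]
  rw [e3, e1, e2, hper, hper, hper, hper]
  exact Bool.xor_self _

/-- **No period for a partnered cubic form.**  If `κ` has degree `≤ 3`, `d` is its cubic form at unit vectors and `c` is a pairing partner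
of `d`, then every period `a` of `κ` is `0`: by `tcf_third_sum1` the vector `a` is in the radical of `d` (`Σ_φ a_φ d_{φjk} = [D_aD_{e_j}D_{e_k}κ]
= 0`), and `tpr_radical_obstruction` applies.  So the partner route to `E1280-even` needs no separate no-period lemma. [this work] -/
theorem tpw_no_period_of_partner {n : ℕ} (κ : (Fin n → Bool) → Bool) (hκ : IsDegLeFun 3 κ) (c d : Fin n → Fin n → Fin n → ZMod 2)
    (hd : ∀ φ j k, d φ j k =
      if (((κ zeroVec ^^ κ (bxor zeroVec (fun l => decide (l = k)))) ^^
            (κ (bxor zeroVec (fun l => decide (l = j))) ^^ κ (bxor (bxor zeroVec (fun l => decide (l = j))) (fun l => decide (l = k))))) ^^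
          ((κ (bxor zeroVec (fun l => decide (l = φ))) ^^ κ (bxor (bxor zeroVec (fun l => decide (l = φ))) (fun l => decide (l = k)))) ^^
            (κ (bxor (bxor zeroVec (fun l => decide (l = φ))) (fun l => decide (l = j))) ^^
              κ (bxor (bxor (bxor zeroVec (fun l => decide (l = φ))) (fun l => decide (l = j))) (fun l => decide (l = k)))))) = true
      then 1 else 0)
    (hpair : ∀ p φ, (∑ j, ∑ k, (if j < k then c p j k * d φ j k else 0)) = if p = φ then 1 else 0)
    (a : Fin n → Bool) (hper : ∀ x, κ (bxor x a) = κ x) : a = zeroVec := by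
  obtain ⟨z, hz⟩ : ∃ z : Fin n → ZMod 2, ∀ i, z i = if a i = true then 1 else 0 :=
    ⟨fun i => if a i = true then 1 else 0, fun i => rfl⟩
  have hza : (fun i => decide (z i = 1)) = a := by
    funext i
    rw [hz i]
    cases a i <;> decide
  have hrad : ∀ j k, (∑ φ, z φ * d φ j k) = 0 := by
    intro j k
    have h := tcf_third_sum1 κ hκ z (fun l => decide (l = j)) (fun l => decide (l = k)) zeroVec
    rw [hza, tpw_third_zero_of_period κ a hper (fun l => decide (l = j)) (fun l => decide (l = k)) zeroVec,
      if_neg Bool.false_ne_true] at h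
    have hsum : (∑ φ, z φ * d φ j k) = ∑ φ, z φ *
        (if (((κ zeroVec ^^ κ (bxor zeroVec (fun l => decide (l = k)))) ^^
            (κ (bxor zeroVec (fun l => decide (l = j))) ^^ κ (bxor (bxor zeroVec (fun l => decide (l = j))) (fun l => decide (l = k))))) ^^
          ((κ (bxor zeroVec (fun l => decide (l = φ))) ^^ κ (bxor (bxor zeroVec (fun l => decide (l = φ))) (fun l => decide (l = k)))) ^^
            (κ (bxor (bxor zeroVec (fun l => decide (l = φ))) (fun l => decide (l = j))) ^^
              κ (bxor (bxor (bxor zeroVec (fun l => decide (l = φ))) (fun l => decide (l = j))) (fun l => decide (l = k)))))) = true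
        then (1 : ZMod 2) else 0) :=
      Finset.sum_congr rfl fun φ _ => by rw [hd φ j k]
    rw [hsum, ← h]
  have hz0 := tpr_radical_obstruction c d hpair z hrad
  funext i
  have hi := congrFun hz0 i
  rw [hz i, Pi.zero_apply] at hi
  show a i = false
  revert hi
  cases a i <;> decide

/-! ### The weight of a partnered cubic is at least `1280`, given the two branch theorems -/

/-- **A partnered cubic form is not the form of `0`.**  If `d` (the cubic form of `κ` at unit vectors) has a pairing partner then `κ`
takes the value `1` somewhere (else `d = 0` and `(PAIR)(p,p)` reads `0 = 1`; needs `n ≥ 1` for a coordinate `p`). [this work] -/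
theorem tpw_pair_weight_pos {n : ℕ} (hn : 0 < n) (κ : (Fin n → Bool) → Bool) (c d : Fin n → Fin n → Fin n → ZMod 2)
    (hd : ∀ φ j k, d φ j k =
      if (((κ zeroVec ^^ κ (bxor zeroVec (fun l => decide (l = k)))) ^^
            (κ (bxor zeroVec (fun l => decide (l = j))) ^^ κ (bxor (bxor zeroVec (fun l => decide (l = j))) (fun l => decide (l = k))))) ^^
          ((κ (bxor zeroVec (fun l => decide (l = φ))) ^^ κ (bxor (bxor zeroVec (fun l => decide (l = φ))) (fun l => decide (l = k)))) ^^
            (κ (bxor (bxor zeroVec (fun l => decide (l = φ))) (fun l => decide (l = j))) ^^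
              κ (bxor (bxor (bxor zeroVec (fun l => decide (l = φ))) (fun l => decide (l = j))) (fun l => decide (l = k)))))) = true
      then 1 else 0)
    (hpair : ∀ p φ, (∑ j, ∑ k, (if j < k then c p j k * d φ j k else 0)) = if p = φ then 1 else 0) :
    0 < #(univ.filter fun x : Fin n → Bool => κ x = true) := by
  rw [Finset.card_pos]
  by_contra hem
  rw [Finset.not_nonempty_iff_eq_empty, filter_eq_empty_iff] at hem
  have hκ0 : ∀ x, κ x = false := fun x => by simpa using hem (mem_univ x)
  have hd0 : ∀ φ j k, d φ j k = 0 := fun φ j k => by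
    rw [hd φ j k]
    simp only [hκ0, Bool.xor_self]
    exact if_neg Bool.false_ne_true
  have h := hpair ⟨0, hn⟩ ⟨0, hn⟩
  rw [if_pos rfl] at h
  have h0 : (∑ j : Fin n, ∑ k : Fin n, (if j < k then c ⟨0, hn⟩ j k * d ⟨0, hn⟩ j k else 0)) = 0 :=
    Finset.sum_eq_zero fun j _ => Finset.sum_eq_zero fun k _ => by rw [hd0, mul_zero, ite_self]
  rw [h0] at h
  exact zero_ne_one h

/-- **E1280-even, partner route, TOP LEVEL (conditional on the two branch theorems).**  Suppose
* `HR2`: every cubic `κ` on 12 bits whose cubic form `d` (at unit vectors) has a symmetric pairing partner `c`, and which has a direction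
  `a ≠ 0` with exactly `1024` points where `κ x ≠ κ(x ⊕ a)`, has `wt κ ≥ 1280` (R2-PARTNER.md + E1280-HANDPROOFS §1), and
* `HR4`: the same with `1536` (R4-PARTNER.md + E1280-HANDPROOFS §2).
Then EVERY cubic `κ` on 12 bits whose cubic form has a symmetric pairing partner has `wt κ ≥ 1280`.
Proof: `wt κ > 0` (`tpw_pair_weight_pos`); if `wt κ < 1280`, `tow_light_derivative` gives `a ≠ 0` with `< 1792` changes, a quadratic count
(`stub_derivDegree`), hence `0`, `1024` or `1536` (`tow_quadratic_light`); `0` makes `a` a period, impossible by `tpw_no_period_of_partner`;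
the other two are `HR2` / `HR4`.  NOT summit progress: `HR2`, `HR4` are not yet kernel theorems. [this work] -/
theorem tpw_weight_ge_1280_of_branches
    (HR2 : ∀ (κ : (Fin (6 + 6) → Bool) → Bool), IsDegLeFun 3 κ →
      ∀ (c d : Fin (6 + 6) → Fin (6 + 6) → Fin (6 + 6) → ZMod 2),
      (∀ p j k, c p k j = c p j k) → (∀ p j k, c j p k = c p j k) → (∀ p j, c p j j = 0) →
      (∀ φ j k, d φ j k =
        if (((κ zeroVec ^^ κ (bxor zeroVec (fun l => decide (l = k)))) ^^
              (κ (bxor zeroVec (fun l => decide (l = j))) ^^ κ (bxor (bxor zeroVec (fun l => decide (l = j))) (fun l => decide (l = k))))) ^^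
            ((κ (bxor zeroVec (fun l => decide (l = φ))) ^^ κ (bxor (bxor zeroVec (fun l => decide (l = φ))) (fun l => decide (l = k)))) ^^
              (κ (bxor (bxor zeroVec (fun l => decide (l = φ))) (fun l => decide (l = j))) ^^
                κ (bxor (bxor (bxor zeroVec (fun l => decide (l = φ))) (fun l => decide (l = j))) (fun l => decide (l = k)))))) = true
        then 1 else 0) →
      (∀ p φ, (∑ j, ∑ k, (if j < k then c p j k * d φ j k else 0)) = if p = φ then 1 else 0) →
      ∀ a : Fin (6 + 6) → Bool, a ≠ zeroVec → #(univ.filter fun x => (κ x ^^ κ (bxor x a)) = true) = 1024 →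
      1280 ≤ #(univ.filter fun x : Fin (6 + 6) → Bool => κ x = true))
    (HR4 : ∀ (κ : (Fin (6 + 6) → Bool) → Bool), IsDegLeFun 3 κ →
      ∀ (c d : Fin (6 + 6) → Fin (6 + 6) → Fin (6 + 6) → ZMod 2),
      (∀ p j k, c p k j = c p j k) → (∀ p j k, c j p k = c p j k) → (∀ p j, c p j j = 0) →
      (∀ φ j k, d φ j k =
        if (((κ zeroVec ^^ κ (bxor zeroVec (fun l => decide (l = k)))) ^^
              (κ (bxor zeroVec (fun l => decide (l = j))) ^^ κ (bxor (bxor zeroVec (fun l => decide (l = j))) (fun l => decide (l = k))))) ^^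
            ((κ (bxor zeroVec (fun l => decide (l = φ))) ^^ κ (bxor (bxor zeroVec (fun l => decide (l = φ))) (fun l => decide (l = k)))) ^^
              (κ (bxor (bxor zeroVec (fun l => decide (l = φ))) (fun l => decide (l = j))) ^^
                κ (bxor (bxor (bxor zeroVec (fun l => decide (l = φ))) (fun l => decide (l = j))) (fun l => decide (l = k)))))) = true
        then 1 else 0) →
      (∀ p φ, (∑ j, ∑ k, (if j < k then c p j k * d φ j k else 0)) = if p = φ then 1 else 0) →
      ∀ a : Fin (6 + 6) → Bool, a ≠ zeroVec → #(univ.filter fun x => (κ x ^^ κ (bxor x a)) = true) = 1536 →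
      1280 ≤ #(univ.filter fun x : Fin (6 + 6) → Bool => κ x = true))
    (κ : (Fin (6 + 6) → Bool) → Bool) (hκ : IsDegLeFun 3 κ) (c d : Fin (6 + 6) → Fin (6 + 6) → Fin (6 + 6) → ZMod 2)
    (hcs : ∀ p j k, c p k j = c p j k) (hcc : ∀ p j k, c j p k = c p j k) (hcd : ∀ p j, c p j j = 0)
    (hd : ∀ φ j k, d φ j k =
      if (((κ zeroVec ^^ κ (bxor zeroVec (fun l => decide (l = k)))) ^^
            (κ (bxor zeroVec (fun l => decide (l = j))) ^^ κ (bxor (bxor zeroVec (fun l => decide (l = j))) (fun l => decide (l = k))))) ^^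
          ((κ (bxor zeroVec (fun l => decide (l = φ))) ^^ κ (bxor (bxor zeroVec (fun l => decide (l = φ))) (fun l => decide (l = k)))) ^^
            (κ (bxor (bxor zeroVec (fun l => decide (l = φ))) (fun l => decide (l = j))) ^^
              κ (bxor (bxor (bxor zeroVec (fun l => decide (l = φ))) (fun l => decide (l = j))) (fun l => decide (l = k)))))) = true
      then 1 else 0)
    (hpair : ∀ p φ, (∑ j, ∑ k, (if j < k then c p j k * d φ j k else 0)) = if p = φ then 1 else 0) :
    1280 ≤ #(univ.filter fun x : Fin (6 + 6) → Bool => κ x = true) := by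
  by_contra hlt
  rw [not_le] at hlt
  have hpos := tpw_pair_weight_pos (by omega) κ c d hd hpair
  obtain ⟨a, ha, hDlt⟩ := tow_light_derivative κ hpos hlt
  have hq2 : IsDegLeFun 2 (fun x => κ x ^^ κ (bxor x a)) := stub_derivDegree (6 + 6) 2 κ a hκ
  rcases tow_quadratic_light _ hq2 hDlt with h0 | h1 | h2
  · -- `a` is a period of `κ`: impossible for a partnered cubic form
    have hem := filter_eq_empty_iff.1 (card_eq_zero.1 h0)
    have hper : ∀ x, κ (bxor x a) = κ x := by
      intro x
      have hx := hem (mem_univ x)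
      revert hx
      cases κ x <;> cases κ (bxor x a) <;> decide
    exact ha (tpw_no_period_of_partner κ hκ c d hd hpair a hper)
  · exact absurd (HR2 κ hκ c d hcs hcc hcd hd hpair a ha h1) (not_le.2 hlt)
  · exact absurd (HR4 κ hκ c d hcs hcc hcd hd hpair a ha h2) (not_le.2 hlt)

end Summit.QuantumAdvantage.QuantumAdvantage.Theorems.CubicForrelation.NearExactIsExact
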